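import Summits.Ventures.PackingBounds.Configurations.Icosahedron
import Summits.Ventures.PackingBounds.Configurations.D4Roots
import Summits.Ventures.PackingBounds.Configurations.KissingD5
import Summits.Ventures.PackingBounds.Configurations.KissingE6
import Summits.Ventures.PackingBounds.Configurations.KissingE7
import Summits.Ventures.PackingBounds.Configurations.E8Roots
import Summits.Ventures.PackingBounds.Kissing.DimensionThree
import Summits.Ventures.PackingBounds.Kissing.DimensionFour
import Summits.Ventures.PackingBounds.ThreePointCert.K5Proof
import Summits.Ventures.PackingBounds.ThreePointCert.K6Proof
import Summits.Ventures.PackingBounds.ThreePointCert.K6d10Proof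
import Summits.Ventures.PackingBounds.ThreePointCert.K7d12Proof
import Summits.Ventures.PackingBounds.ThreePointCert.K5d14Proof
import Summits.Ventures.PackingBounds.Configurations.LeechSections
import Summits.Ventures.PackingBounds.Configurations.CohnLi

/-!
# Kissing numbers in dimensions `3`–`8`: the two-sided brackets held in Lean

Framing: lottery ticket; floor = certified bounds/negative ranges. Venture `PackingBounds` (cell
`pub-packcert`) — summary of the formally proved brackets `lower ≤ κ(n) ≤ upper`, where
`kissingSizes n` is the set of cardinalities of kissing configurations (finite sets of unit vectors of
`ℝⁿ` with pairwise inner products `≤ 1/2`). Lower ends: explicit configurations of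
`Configurations/` (icosahedron, 24-cell, `D₅`, `E₆`, `E₇`, `E₈`; distance distributions checked by the
kernel). Upper ends: the cell's kernel-checked certificates — Delsarte LP (`Kissing/`) and
Bachoc–Vallentin three-point SDP (`ThreePointCert/K5Proof`, `K6Proof`).

| `n` | bracket in Lean | in print |
|---|---|---|
| 3 | `12 ≤ κ ≤ 13` | `κ = 12` (Schütte–van der Waerden) |
| 4 | `24 ≤ κ ≤ 25` | `κ = 24` (Musin) |
| 5 | `40 ≤ κ ≤ 45` | `40 ≤ κ ≤ 44` |
| 6 | `72 ≤ κ ≤ 79` | `72 ≤ κ ≤ 77` |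
| 7 | `126 ≤ κ ≤ 140` | `126 ≤ κ ≤ 134` |
| 8 | `κ = 240` | `κ = 240` (Odlyzko–Sloane, Levenshtein) |

## References
* J. H. Conway, N. J. A. Sloane, *Sphere Packings, Lattices and Groups*, Ch. 1 Table 1.2. [`ConwaySloane1999`]
-/

namespace Summit.Ventures.PackingBounds.Config

open Finset

/-- The set of sizes of kissing configurations in `ℝⁿ`: cardinalities of finite sets of unit vectors with
pairwise inner products at most `1/2` (i.e. pairwise angles `≥ 60°`). -/
def kissingSizes (n : ℕ) : Set ℕ :=
  {N : ℕ | ∃ C : Finset (EuclideanSpace ℝ (Fin n)), C.card = N ∧ (∀ x ∈ C, ‖x‖ = 1) ∧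
    (∀ x ∈ C, ∀ y ∈ C, x ≠ y → inner ℝ x y ≤ 1 / 2)}

/-- **`12 ≤ κ(3) ≤ 13` in Lean** (icosahedron; Delsarte LP degree 10). [cite: ConwaySloane1999, Ch. 1 Table 1.2] -/
theorem kissing_dim3_bracket : 12 ∈ kissingSizes 3 ∧ ∀ N ∈ kissingSizes 3, N ≤ 13 := by
  refine ⟨?_, ?_⟩
  · obtain ⟨C, hc, h1, h2⟩ := Icosahedron.exists_code_12
    refine ⟨C, hc, h1, fun x hx y hy hxy => (h2 x hx y hy hxy).trans ?_⟩
    have hhi : Real.sqrt 5 < 2.5 := (Real.sqrt_lt' (by norm_num)).mpr (by norm_num)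
    linarith
  · rintro N ⟨C, rfl, h1, h2⟩
    exact Kissing.kissing_dim3_le_13 C h1 h2

/-- **`24 ≤ κ(4) ≤ 25` in Lean** (24-cell; Delsarte LP). [cite: ConwaySloane1999, Ch. 1 Table 1.2] -/
theorem kissing_dim4_bracket : 24 ∈ kissingSizes 4 ∧ ∀ N ∈ kissingSizes 4, N ≤ 25 := by
  refine ⟨D4.exists_kissing_24, ?_⟩
  rintro N ⟨C, rfl, h1, h2⟩
  exact Kissing.kissing_dim4_le_25 C h1 h2

/-- **`40 ≤ κ(5) ≤ 45` in Lean** (`D₅` roots; Bachoc–Vallentin SDP, kernel-checked). [cite: ConwaySloane1999, Ch. 1 Table 1.2] -/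
theorem kissing_dim5_bracket : 40 ∈ kissingSizes 5 ∧ ∀ N ∈ kissingSizes 5, N ≤ 45 := by
  refine ⟨KissingD5.exists_kissing_40, ?_⟩
  rintro N ⟨C, rfl, h1, h2⟩
  exact ThreePointCert.K5.kissing_dim5_le_45_sdp C h1 h2

/-- **`72 ≤ κ(6) ≤ 79` in Lean** (`E₆` roots; Bachoc–Vallentin SDP, kernel-checked). [cite: ConwaySloane1999, Ch. 1 Table 1.2] -/
theorem kissing_dim6_bracket : 72 ∈ kissingSizes 6 ∧ ∀ N ∈ kissingSizes 6, N ≤ 79 := by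
  refine ⟨KissingE6.exists_kissing_72, ?_⟩
  rintro N ⟨C, rfl, h1, h2⟩
  exact ThreePointCert.K6.kissing_dim6_le_79_sdp C h1 h2

/-- **`126 ≤ κ(7) ≤ 140` in Lean** (`E₇` roots; Delsarte LP). [cite: ConwaySloane1999, Ch. 1 Table 1.2] -/
theorem kissing_dim7_bracket : 126 ∈ kissingSizes 7 ∧ ∀ N ∈ kissingSizes 7, N ≤ 140 := by
  refine ⟨KissingE7.exists_kissing_126, ?_⟩
  rintro N ⟨C, rfl, h1, h2⟩
  exact Kissing.kissing_dim7_le_140 C h1 h2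

/-- **`κ(8) = 240` in Lean**: `240` is the greatest element of `kissingSizes 8` (`E₈` roots; Delsarte LP).
[cite: ConwaySloane1999, Ch. 1 Table 1.2] -/
theorem kissing_dim8_eq : IsGreatest (kissingSizes 8) 240 :=
  E8.kissing_dim8_isGreatest

/-- **`11692 ≤ κ(19) ≤ 25900` in Lean** (Cohn–Li 2024 configuration from the Golay code; Delsarte LP).
[cite: ConwaySloane1999, Ch. 1 Table 1.2] -/
theorem kissing_dim19_bracket : 11692 ∈ kissingSizes 19 ∧ ∀ N ∈ kissingSizes 19, N ≤ 25900 := by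
  refine ⟨Leech.exists_kissing_11692, ?_⟩
  rintro N ⟨C, rfl, h1, h2⟩
  exact Kissing.kissing_dim19_le_25900 C h1 h2

/-- **`19448 ≤ κ(20) ≤ 37974` in Lean** (Cohn–Li 2024 configuration; Delsarte LP).
[cite: ConwaySloane1999, Ch. 1 Table 1.2] -/
theorem kissing_dim20_bracket : 19448 ∈ kissingSizes 20 ∧ ∀ N ∈ kissingSizes 20, N ≤ 37974 := by
  refine ⟨Leech.exists_kissing_19448, ?_⟩
  rintro N ⟨C, rfl, h1, h2⟩
  exact Kissing.kissing_dim20_le_37974 C h1 h2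

/-- **`29768 ≤ κ(21) ≤ 56851` in Lean** (Cohn–Li 2024 configuration — their record, improving Leech's laminated
`27720` = `Leech.exists_kissing_27720`; Delsarte LP). [cite: ConwaySloane1999, Ch. 1 Table 1.2] -/
theorem kissing_dim21_bracket : 29768 ∈ kissingSizes 21 ∧ ∀ N ∈ kissingSizes 21, N ≤ 56851 := by
  refine ⟨Leech.exists_kissing_29768, ?_⟩
  rintro N ⟨C, rfl, h1, h2⟩
  exact Kissing.kissing_dim21_le_56851 C h1 h2

/-- **`49896 ≤ κ(22) ≤ 86537` in Lean** (`Λ₂₂` kissing configuration from the Leech lattice; Delsarte LP).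
[cite: ConwaySloane1999, Ch. 1 Table 1.2] -/
theorem kissing_dim22_bracket : 49896 ∈ kissingSizes 22 ∧ ∀ N ∈ kissingSizes 22, N ≤ 86537 := by
  refine ⟨Leech.exists_kissing_49896, ?_⟩
  rintro N ⟨C, rfl, h1, h2⟩
  exact Kissing.kissing_dim22_le_86537 C h1 h2

/-- **`93150 ≤ κ(23) ≤ 128095` in Lean** (`Λ₂₃` kissing configuration from the Leech lattice; Delsarte LP).
[cite: ConwaySloane1999, Ch. 1 Table 1.2] -/
theorem kissing_dim23_bracket : 93150 ∈ kissingSizes 23 ∧ ∀ N ∈ kissingSizes 23, N ≤ 128095 := by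
  refine ⟨Leech.exists_kissing_93150, ?_⟩
  rintro N ⟨C, rfl, h1, h2⟩
  exact Kissing.kissing_dim23_le_128095 C h1 h2

/-- **`κ(24) = 196560` in Lean** (Leech lattice minimal vectors; sharp Delsarte LP), restated on `kissingSizes`
(see also `Config.kissing_dim24_eq` in `KissingExact.lean`). [cite: ConwaySloane1999, Ch. 1 Table 1.2] -/
theorem kissing_dim24_isGreatest : IsGreatest (kissingSizes 24) 196560 :=
  Leech.kissing_dim24_isGreatest

/-- **`72 ≤ κ(6) ≤ 78` in Lean** (`E₆` roots; Bachoc–Vallentin three-point SDP of degree 10 from an exact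
certificate of the cell, kernel-checked: `ThreePointCert.K6d10.kissing_dim6_le_78_sdp`). Sharpens
`kissing_dim6_bracket` (`≤ 79`). In print: `72 ≤ κ(6) ≤ 77` (the three-point bound gives `78` at every
degree computed; `77` is the exact second-level Lasserre bound of de Laat–Leijenhorst–de Muinck Keizer 2024).
[cite: BachocVallentin2007, Theorem 4.2] [cite: ConwaySloane1999, Ch. 1 Table 1.2] -/
theorem kissing_dim6_bracket_78 : 72 ∈ kissingSizes 6 ∧ ∀ N ∈ kissingSizes 6, N ≤ 78 := by
  refine ⟨KissingE6.exists_kissing_72, ?_⟩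
  rintro N ⟨C, rfl, h1, h2⟩
  exact ThreePointCert.K6d10.kissing_dim6_le_78_sdp C h1 h2

/-- **`126 ≤ κ(7) ≤ 134` in Lean** (`E₇` roots; Bachoc–Vallentin three-point SDP of degree 12 from an exact
certificate of the cell (bound value `134.8956…`), kernel-checked:
`ThreePointCert.K7d12.kissing_dim7_le_134_sdp`). Sharpens `kissing_dim7_bracket` (`≤ 140`, Delsarte LP) to the
best bound in print (`134`, rigorous at degree 16 in Machado–de Oliveira Filho 2018; `134.4488…` at degree 14
in Mittelmann–Vallentin 2010). [cite: BachocVallentin2007, Theorem 4.2] [cite: ConwaySloane1999, Ch. 1 Table 1.2] -/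
theorem kissing_dim7_bracket_134 : 126 ∈ kissingSizes 7 ∧ ∀ N ∈ kissingSizes 7, N ≤ 134 := by
  refine ⟨KissingE7.exists_kissing_126, ?_⟩
  rintro N ⟨C, rfl, h1, h2⟩
  exact ThreePointCert.K7d12.kissing_dim7_le_134_sdp C h1 h2

/-- The kernel-checked kissing brackets of dimensions `5`, `6`, `7` in one statement:
`40 ≤ κ(5) ≤ 45`, `72 ≤ κ(6) ≤ 78`, `126 ≤ κ(7) ≤ 134` (lower ends `D₅`, `E₆`, `E₇`; upper ends
Bachoc–Vallentin three-point certificates of degrees 10, 10, 12). In print: `40–44`, `72–77`, `126–134`.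
[cite: BachocVallentin2007, Theorem 4.2] [cite: ConwaySloane1999, Ch. 1 Table 1.2] -/
theorem kissing_brackets_dims_5_6_7 :
    (40 ∈ kissingSizes 5 ∧ ∀ N ∈ kissingSizes 5, N ≤ 45) ∧
    (72 ∈ kissingSizes 6 ∧ ∀ N ∈ kissingSizes 6, N ≤ 78) ∧
    (126 ∈ kissingSizes 7 ∧ ∀ N ∈ kissingSizes 7, N ≤ 134) :=
  ⟨kissing_dim5_bracket, kissing_dim6_bracket_78, kissing_dim7_bracket_134⟩

/-- **`40 ≤ κ(5) ≤ 44` in Lean** (`D₅` roots; Bachoc–Vallentin three-point SDP with their multiplier set, degree 14,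
from the exact certificate `sdp-d5-deg14-sym2-lp-v1.json` of the cell (bound value `44.99963…`), kernel-checked:
`ThreePointCert.K5d14.kissing_dim5_le_44_sdp`). Sharpens `kissing_dim5_bracket` (`≤ 45`, degree 10) to the best
bound in print (`44`: `44.99899685` at degree 14 in Mittelmann–Vallentin 2010, rigorous `44.981067` at degree 16 in
Machado–de Oliveira Filho 2018). [cite: BachocVallentin2007, Theorem 4.2] [cite: ConwaySloane1999, Ch. 1 Table 1.2] -/
theorem kissing_dim5_bracket_44 : 40 ∈ kissingSizes 5 ∧ ∀ N ∈ kissingSizes 5, N ≤ 44 := by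
  refine ⟨KissingD5.exists_kissing_40, ?_⟩
  rintro N ⟨C, rfl, h1, h2⟩
  exact ThreePointCert.K5d14.kissing_dim5_le_44_sdp C h1 h2

/-- The kernel-checked kissing brackets of dimensions `5`, `6`, `7` after the degree-14 row:
`40 ≤ κ(5) ≤ 44`, `72 ≤ κ(6) ≤ 78`, `126 ≤ κ(7) ≤ 134` — equal to the brackets in print for `d = 5` and
`d = 7` (in print `κ(6) ≤ 77` by the second Lasserre level). [cite: BachocVallentin2007, Theorem 4.2]
[cite: ConwaySloane1999, Ch. 1 Table 1.2] -/
theorem kissing_brackets_dims_5_6_7_deg14 :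
    (40 ∈ kissingSizes 5 ∧ ∀ N ∈ kissingSizes 5, N ≤ 44) ∧
    (72 ∈ kissingSizes 6 ∧ ∀ N ∈ kissingSizes 6, N ≤ 78) ∧
    (126 ∈ kissingSizes 7 ∧ ∀ N ∈ kissingSizes 7, N ≤ 134) :=
  ⟨kissing_dim5_bracket_44, kissing_dim6_bracket_78, kissing_dim7_bracket_134⟩

end Summit.Ventures.PackingBounds.Config
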